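import Summits.HubbardSuperconductivity.HubbardSuperconductivity.Theorems.CwThesis.Negative.FreeEndpointCorollaries
import Summits.HubbardSuperconductivity.HubbardSuperconductivity.Theorems.ChiralWindowCwThesisRingReductions

/-!
# Crux `CwThesis` (item `stmt-HubbardSuperconductivity-10438`), line `SketchIdeator2`: the engine
`stub_ringTraces` is FALSE at `U = 0` — `0 < U` is load-bearing for the ring line too

Negative-side bookkeeping for the ring line (lead prover, after the standing disprover's free-endpoint theorem):

* `ringTracesAt_zero_false` — at `U = 0` NO doping `δ ≥ 0` admits ring-trace constants: if `κ, c > 0`,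
  `θ ∈ [0,1)` gave, eventually along `L = 2(k+1)`, the ring-trace bound
  `Re tr((Q_p - cL⁴)² e^{-κL H_p}) · Re Z_{κL}(H_p) ≤ (θcL⁴)² · Re Z_{2κL}(H_p)` for the `(n,n)`-block compressions
  of the FREE torus `hubbardTorus 2 L 1 0` and `Δ_d†Δ_d`, then `matrix_of_ringTracesAt` would give the summit
  matrix at `(0, δ)`, which `not_hasDWavePairFieldLROAt_zero` refutes (every free sector ground state has pair
  intensity `≤ 320 L²`);
* `ringTraces_false_at_zero` — hence the `U = 0` analogue of the engine (the window doping `δ_U` still free) is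
  false: like every constant of any proof of `CwThesis` (Disproof.lean §6/§7), the ring-trace centre `c = c(U)`
  must degenerate as `U → 0⁺`.

Folklore; no definitions; nothing asserts a Theses declaration.
-/

noncomputable section

namespace Summit.HubbardSuperconductivity.CwThesis.Negative

-- `DecidableEq {s : Finset (Orb Λ) // …}` (the `(n,n)`-block index) exceeds the default instance size budget
set_option synthInstance.maxSize 512

open Literature.MathematicalPhysics.QuantumLattice Literature.Barriers.HubbardSuperconductivity
open Summit.HubbardSuperconductivity.HubbardSuperconductivity.Theorems.CwThesis
open Set Matrix Filter

/-- **No ring-trace constants at `U = 0`, at any doping `δ ≥ 0`.** For the free torus, no `κ, c > 0`,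
`θ ∈ [0,1)` satisfy the ring-trace bound of line `SketchIdeator2` eventually along `L = 2(k+1)`: otherwise
`matrix_of_ringTracesAt 0 δ` yields the summit matrix at `(0, δ)` (= `HasDWavePairFieldLROAt 0 δ` by `Iff.rfl`),
contradicting `not_hasDWavePairFieldLROAt_zero`. [folklore] -/
theorem ringTracesAt_zero_false {δ : ℝ} (hδ : 0 ≤ δ) :
    ¬ ∃ κ c θ : ℝ, 0 < κ ∧ 0 < c ∧ 0 ≤ θ ∧ θ < 1 ∧ ∀ᶠ k : ℕ in atTop,
      let L : ℕ := 2 * (k + 1)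
      let n : ℕ := ⌊(1 - δ) * (L : ℝ) ^ 2 / 2⌋₊
      let Hp := (hubbardTorus 2 L 1 0).toBlock
        (fun s => (upPart s).card = n ∧ (downPart s).card = n)
        (fun s => (upPart s).card = n ∧ (downPart s).card = n)
      let Qp := ((pairField dWaveFormFactor L)ᴴ * pairField dWaveFormFactor L).toBlock
        (fun s => (upPart s).card = n ∧ (downPart s).card = n)
        (fun s => (upPart s).card = n ∧ (downPart s).card = n)
      let D := Qp - ((c * (L : ℝ) ^ 4 : ℝ) : ℂ) • 1
      (D * D * Matrix.gibbsWeight (κ * (L : ℝ)) Hp).trace.re *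
          (Matrix.partitionFn (κ * (L : ℝ)) Hp).re ≤
        (θ * c * (L : ℝ) ^ 4) ^ 2 * (Matrix.partitionFn (2 * (κ * (L : ℝ))) Hp).re := by
  intro h
  exact not_hasDWavePairFieldLROAt_zero hδ (matrix_of_ringTracesAt 0 δ hδ h)

/-- **The `U = 0` analogue of `stub_ringTraces` is false**: no doping of the window `[3/10, 12/25]` carries
ring-trace constants for the free torus. The engine of line `SketchIdeator2` uses `0 < U` quantitatively; its
centre `c(U)` cannot stay bounded below as `U → 0⁺` (cf. `cwThesis_false_uniformFloor`). [folklore] -/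
theorem ringTraces_false_at_zero :
    ¬ ∃ δ ∈ Icc (3/10 : ℝ) (12/25), ∃ κ c θ : ℝ, 0 < κ ∧ 0 < c ∧ 0 ≤ θ ∧ θ < 1 ∧ ∀ᶠ k : ℕ in atTop,
      let L : ℕ := 2 * (k + 1)
      let n : ℕ := ⌊(1 - δ) * (L : ℝ) ^ 2 / 2⌋₊
      let Hp := (hubbardTorus 2 L 1 0).toBlock
        (fun s => (upPart s).card = n ∧ (downPart s).card = n)
        (fun s => (upPart s).card = n ∧ (downPart s).card = n)
      let Qp := ((pairField dWaveFormFactor L)ᴴ * pairField dWaveFormFactor L).toBlock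
        (fun s => (upPart s).card = n ∧ (downPart s).card = n)
        (fun s => (upPart s).card = n ∧ (downPart s).card = n)
      let D := Qp - ((c * (L : ℝ) ^ 4 : ℝ) : ℂ) • 1
      (D * D * Matrix.gibbsWeight (κ * (L : ℝ)) Hp).trace.re *
          (Matrix.partitionFn (κ * (L : ℝ)) Hp).re ≤
        (θ * c * (L : ℝ) ^ 4) ^ 2 * (Matrix.partitionFn (2 * (κ * (L : ℝ))) Hp).re := by
  rintro ⟨δ, hδ, h⟩
  exact ringTracesAt_zero_false (by linarith [hδ.1]) h

end Summit.HubbardSuperconductivity.CwThesis.Negative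

end
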